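import Literature.NumberTheory.EllipticCurves.PeriodLatticeGamma1QuotientProofs
import Literature.NumberTheory.LFunctions.PrimitiveQuadraticCharacterKroneckerEven
import HarnessLib

/-!
# Sign characters of `Γ₀(N)` trivial on `Γ₁(N)` are Kronecker symbols

(route `ManinLocalTwoThree`, crux C2 `ManinOddAtFour` stmt-BirchSwinnertonDyer-22967; cell bsd-f2-manin, prover p3 gen 19;
ANCHOR DISCHARGE, part I of the E-an-152d port.)

The Galois engine of the E-an-152d port (`…CDivisionGaloisEngine.false_of_conj_moves_class`) carries an *anchor
hypothesis*: for every sign character `χ : Γ₀(N) → {±1}` which is multiplicative, trivial on `Γ₁(N)` (i.e. on the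
matrices with `d ≡ 1 (mod N)`) and trivial on the translations (`c = 0`), there should be a holomorphic, cusp-bounded,
nowhere-vanishing form `g` with rational `q`-expansion and `g ∣ γ = χ(γ) g` on some `Γ₀(N')`, `N ∣ N'`.  This file does
the arithmetic half of the discharge: such a `χ` factors through `d mod N`, i.e. is an even quadratic Dirichlet
character `ψ` mod `N` (Diamond–Shurman §1.2: `Γ₀(N)/Γ₁(N) ≅ (ℤ/N)ˣ` via `γ ↦ d_γ`), and by Montgomery–Vaughan's
Theorem 9.13 (tree: `PrimitiveQuadratic.apply_natCast_eq_jacobiSym_of_even`) the primitive character inducing `ψ`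
is the Kronecker symbol `(q₀/·)`, `q₀ ∣ N` its conductor; hence `χ(γ) = (q₀ / |d_γ|)` whenever `d_γ` is odd.
Part II (`…AnchorForms`) then supplies `g = ϑ₄(2τ)³ϑ₄(2q₀τ)` on `Γ₀(16N)`.

BSD is not proved here; this is a helper toward the conditional closure `C2 ⟸ CDT ∧ E-an-152e`.
-/

open scoped MatrixGroups NumberTheorySymbols
open CongruenceSubgroup DirichletCharacter

namespace Summit.BirchSwinnertonDyer.BirchSwinnertonDyer.Theorems.ManinLocalTwoThree.EtaAnchor

/-- The primitive character inducing an even Dirichlet character is even (`χ⋆(−1) = χ(−1)`, as `−1` is coprime to the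
level). [folklore] -/
private theorem primitiveCharacter_even_aux {q : ℕ} [NeZero q] {χ : DirichletCharacter ℂ q} (heven : χ.Even) :
    χ.primitiveCharacter.Even := by
  have h := DirichletCharacter.primitiveCharacter_apply_of_isCoprime χ (a := -1) (isCoprime_one_left.neg_left)
  rw [DirichletCharacter.Even]
  push_cast at h
  rw [h]
  exact heven

/-- The primitive character inducing a quadratic Dirichlet character is quadratic. [folklore] -/
private theorem primitiveCharacter_isQuadratic_aux {q : ℕ} [NeZero q] {χ : DirichletCharacter ℂ q}
    (hquad : χ.IsQuadratic) : χ.primitiveCharacter.IsQuadratic := by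
  haveI : NeZero χ.conductor := ⟨χ.conductor_ne_zero⟩
  have hsq : χ ^ 2 = 1 := hquad.sq_eq_one
  have hsq₀ : χ.primitiveCharacter ^ 2 = 1 := by
    refine (changeLevel_eq_one_iff χ.conductor_dvd_level).mp ?_
    rw [map_pow, changeLevel_primitiveCharacter, hsq]
  intro a
  by_cases ha : IsUnit a
  · right
    have h := MulChar.pow_apply' χ.primitiveCharacter two_ne_zero a
    rw [hsq₀, MulChar.one_apply ha] at h
    have h2 : χ.primitiveCharacter a * χ.primitiveCharacter a = 1 := by
      rw [← pow_two]; exact h.symm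
    rcases mul_self_eq_one_iff.mp h2 with h' | h'
    · exact Or.inl h'
    · exact Or.inr h'
  · exact Or.inl (χ.primitiveCharacter.map_nonunit ha)

variable {N : ℕ} [NeZero N]

omit [NeZero N] in
/-- `Γ₀(N) → ℤ/N`, `γ ↦ d_γ mod N`, in coordinates. [cite: DiamondShurman2005, §1.2] -/
private theorem gamma0Map_apply (γ : Gamma0 N) : Gamma0Map N γ = ((((γ : SL(2, ℤ)) 1 1 : ℤ)) : ZMod N) := rfl

/-- `d_γ mod N` is a unit for `γ ∈ Γ₀(N)`. [cite: DiamondShurman2005, §1.2] -/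
private theorem isUnit_gamma0Map (γ : Gamma0 N) : IsUnit (Gamma0Map N γ) :=
  IsUnit.of_mul_eq_one (Gamma0Map N γ⁻¹) (by rw [← map_mul, mul_inv_cancel, map_one])

/-- **A sign character of `Γ₀(N)` that is trivial on `Γ₁(N)` and on the translations is a Kronecker symbol at the
lower-right entry.**  Let `χ : SL(2, ℤ) → ℤ` take the values `±1` on `Γ₀(N)`, be multiplicative there, and be `1` on
every `γ ∈ Γ₀(N)` with `d_γ ≡ 1 (mod N)` and on every `γ` with `c_γ = 0`.  Then there is `q₀ ≥ 1`, `q₀ ∣ N` (the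
conductor of the even quadratic Dirichlet character `d ↦ χ(γ_d)` mod `N`) with `χ(γ) = (q₀ / |d_γ|)` (Jacobi symbol) for
every `γ ∈ Γ₀(N)` with `d_γ` odd.  (Surjectivity of `γ ↦ d_γ` onto `(ℤ/N)ˣ`: Diamond–Shurman §1.2; primitive even
quadratic characters are `(D/·)`, `D > 0`: Montgomery–Vaughan Thm. 9.13.)
[cite: DiamondShurman2005, §1.2] [cite: MontgomeryVaughan2007, Theorem 9.13] -/
theorem exists_eq_jacobiSym_of_signCharacter (χ : SL(2, ℤ) → ℤ)
    (h1 : ∀ γ ∈ Gamma0 N, χ γ = 1 ∨ χ γ = -1)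
    (h2 : ∀ γ ∈ Gamma0 N, ∀ δ ∈ Gamma0 N, χ (γ * δ) = χ γ * χ δ)
    (h3 : ∀ γ ∈ Gamma0 N, ((γ 1 1 : ℤ) : ZMod N) = 1 → χ γ = 1)
    (h4 : ∀ γ ∈ Gamma0 N, γ 1 0 = 0 → χ γ = 1) :
    ∃ q₀ : ℕ, 0 < q₀ ∧ q₀ ∣ N ∧ ∀ γ ∈ Gamma0 N, Odd (γ 1 1) → χ γ = J((q₀ : ℤ) | (γ 1 1).natAbs) := by
  classical
  -- (a) `χ` depends only on `d mod N`
  have hwd : ∀ γ δ : Gamma0 N, Gamma0Map N γ = Gamma0Map N δ → χ γ = χ δ := by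
    intro γ δ hγδ
    have hε : Gamma0Map N (γ * δ⁻¹) = 1 := by
      rw [map_mul, hγδ, ← map_mul, mul_inv_cancel, map_one]
    have hχε : χ ((γ * δ⁻¹ : Gamma0 N) : SL(2, ℤ)) = 1 := h3 _ (γ * δ⁻¹).2 hε
    have hmul := h2 _ (γ * δ⁻¹).2 _ δ.2
    rw [hχε, one_mul, Subgroup.coe_mul, Subgroup.coe_inv, inv_mul_cancel_right] at hmul
    exact hmul
  -- (b) lifts of the units (`γ ↦ d_γ` is onto `(ℤ/N)ˣ`)
  have hlift : ∀ u : (ZMod N)ˣ, ∃ γ : Gamma0 N, Gamma0Map N γ = (u : ZMod N) := fun u ↦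
    Literature.NumberTheory.EllipticCurves.ModularForms.exists_gamma0_apply_one_one_eq_of_isUnit u.isUnit
  choose L hL using hlift
  have hs1 : ∀ u, χ (L u) = 1 ∨ χ (L u) = -1 := fun u ↦ h1 _ (L u).2
  have hsmul : ∀ u v, χ (L (u * v)) = χ (L u) * χ (L v) := by
    intro u v
    have h : χ (L (u * v)) = χ ((L u * L v : Gamma0 N) : SL(2, ℤ)) :=
      hwd (L (u * v)) (L u * L v) (by rw [map_mul, hL, hL, hL, Units.val_mul])
    rw [h, Subgroup.coe_mul, h2 _ (L u).2 _ (L v).2]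
  have hL1 : χ (L 1) = 1 := h3 _ (L 1).2 (by rw [← gamma0Map_apply, hL, Units.val_one])
  -- (c) the Dirichlet character `ψ(d) = χ(γ_d)`
  set g : (ZMod N)ˣ → ℂˣ := fun u ↦ if χ (L u) = 1 then 1 else -1 with hg
  have hg_mul : ∀ u v, g (u * v) = g u * g v := by
    intro u v
    simp only [hg]
    rcases hs1 u with hu | hu <;> rcases hs1 v with hv | hv
    · rw [if_pos (by rw [hsmul, hu, hv]; norm_num), if_pos hu, if_pos hv, one_mul]
    · rw [if_neg (by rw [hsmul, hu, hv]; norm_num), if_pos hu, if_neg (by rw [hv]; norm_num), one_mul]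
    · rw [if_neg (by rw [hsmul, hu, hv]; norm_num), if_neg (by rw [hu]; norm_num), if_pos hv, mul_one]
    · rw [if_pos (by rw [hsmul, hu, hv]; norm_num), if_neg (by rw [hu]; norm_num), if_neg (by rw [hv]; norm_num),
        neg_mul_neg, one_mul]
  have hg_one : g 1 = 1 := by simp only [hg, if_pos hL1]
  let φ : (ZMod N)ˣ →* ℂˣ := { toFun := g, map_one' := hg_one, map_mul' := hg_mul }
  set ψ : DirichletCharacter ℂ N := MulChar.ofUnitHom φ with hψdef
  have hval : ∀ u : (ZMod N)ˣ, ψ (u : ZMod N) = ((χ (L u) : ℤ) : ℂ) := by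
    intro u
    rw [hψdef, MulChar.ofUnitHom_coe]
    show ((g u : ℂˣ) : ℂ) = _
    rcases hs1 u with hu | hu
    · simp [hg, hu]
    · simp [hg, hu]
  -- `χ(γ) = ψ(d_γ)` on `Γ₀(N)`
  have hχψ : ∀ (γ : SL(2, ℤ)) (hγ : γ ∈ Gamma0 N), ((χ γ : ℤ) : ℂ) = ψ (((γ 1 1 : ℤ)) : ZMod N) := by
    intro γ hγ
    obtain ⟨u, hu⟩ := isUnit_gamma0Map ⟨γ, hγ⟩
    rw [gamma0Map_apply] at hu
    rw [← hu, hval u, hwd (L u) ⟨γ, hγ⟩ (by rw [hL, gamma0Map_apply, hu])]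
  -- `ψ` is even (`χ(−1) = 1` since `c = 0`) and quadratic
  have heven : ψ.Even := by
    have hm1 : (-1 : SL(2, ℤ)) ∈ Gamma0 N := by rw [Gamma0_mem]; simp
    have h := hχψ (-1) hm1
    have e : ((-1 : SL(2, ℤ)) 1 1 : ℤ) = -1 := by simp
    rw [h4 _ hm1 (by simp), e] at h
    push_cast at h
    exact h.symm
  have hquad : ψ.IsQuadratic := by
    intro a
    by_cases ha : IsUnit a
    · obtain ⟨u, rfl⟩ := ha
      rw [hval]
      rcases hs1 u with hu | hu
      · exact Or.inr (Or.inl (by rw [hu]; simp))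
      · exact Or.inr (Or.inr (by rw [hu]; simp))
    · exact Or.inl (MulChar.map_nonunit ψ ha)
  -- (d) primitive reduction and Montgomery–Vaughan 9.13
  haveI : NeZero ψ.conductor := ⟨ψ.conductor_ne_zero⟩
  refine ⟨ψ.conductor, Nat.pos_of_ne_zero ψ.conductor_ne_zero, ψ.conductor_dvd_level, fun γ hγ hodd ↦ ?_⟩
  have hprim := ψ.primitiveCharacter_isPrimitive
  have heven₀ := primitiveCharacter_even_aux heven
  have hquad₀ := primitiveCharacter_isQuadratic_aux hquad
  have hcop : IsCoprime (γ 1 1 : ℤ) (N : ℤ) := by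
    have hu := isUnit_gamma0Map ⟨γ, hγ⟩
    rw [gamma0Map_apply] at hu
    exact ((ZMod.coe_int_isUnit_iff_isCoprime _ N).mp hu).symm
  have hψ₀d : ψ.primitiveCharacter ((γ 1 1 : ℤ) : ZMod ψ.conductor) = ψ (((γ 1 1 : ℤ)) : ZMod N) :=
    ψ.primitiveCharacter_apply_of_isCoprime hcop
  have hn : Odd (γ 1 1).natAbs := Int.natAbs_odd.mpr hodd
  have hMV : ψ.primitiveCharacter (((γ 1 1).natAbs : ℕ) : ZMod ψ.conductor) = (J((ψ.conductor : ℤ) | (γ 1 1).natAbs) : ℂ) :=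
    Literature.NumberTheory.LFunctions.PrimitiveQuadratic.apply_natCast_eq_jacobiSym_of_even hprim hquad₀ heven₀ hn
  have hψd : ψ.primitiveCharacter ((γ 1 1 : ℤ) : ZMod ψ.conductor) = (J((ψ.conductor : ℤ) | (γ 1 1).natAbs) : ℂ) := by
    rcases Int.natAbs_eq (γ 1 1) with hd | hd
    · conv_lhs => rw [hd, Int.cast_natCast]
      exact hMV
    · conv_lhs => rw [hd, Int.cast_neg, Int.cast_natCast]
      rw [heven₀.eval_neg, hMV]
  have hfinal : ((χ γ : ℤ) : ℂ) = ((J((ψ.conductor : ℤ) | (γ 1 1).natAbs) : ℤ) : ℂ) := by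
    rw [hχψ γ hγ, ← hψ₀d, hψd]
  exact_mod_cast hfinal

end Summit.BirchSwinnertonDyer.BirchSwinnertonDyer.Theorems.ManinLocalTwoThree.EtaAnchor
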